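import Summits.QuantumFields.YangMills.Theorems.UnitScaleTiltProp7DeltaPiDefectPairing
import Summits.QuantumFields.YangMills.Theorems.UnitScaleTiltProp7SectET3WilsonHessianT3RealityRows
import Summits.QuantumFields.YangMills.Theorems.UnitScaleTiltProp7RieszTauFrobNormT3
import Summits.QuantumFields.YangMills.Theorems.UnitScaleTiltProp7SectET3RealCoordSums
import HarnessLib

/-!
# Route `UnitScaleTilt`, crux K1 «MinimiserStabilityRegPr» (stmt-QuantumFields-19200), EX row `norm_G` — NORM_G ROAD brick N6, FILE A (★px19 g14 LOCATE-N6 fa94c431 §4 item 1):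
# **THE TWO (3.117) CURRENT PAIRINGS AS POINTWISE `O(α)` MULTIPLIERS** — (C-val) `‖(Δ^η_{U₀}(D_{U₀}λ))(b)‖ ≤ 2α(‖λ(b₋)‖ + ‖λ(b₊)‖)` and (C-div) `‖(D*_{U₀}Δ^η_{U₀}F)(x)‖ ≤ 12α·sup‖F‖`
# on the printed-regular class `RegPr F n K α U₀` — NO `η` LOSS ([Balaban1985BackgroundPropagators] (3.117) p.419 × the divergence clause (1.9) of [Balaban1985RegularSpaces])

Cell `ym3-torus` (HUMAN RULING D-0037; rung R3 = SU(2) YM₃ on T³ — NOT d = 4, NOT infinite volume, NOT a mass gap, NOT Clay).  Fleet lead ∕ chair seat `ym-ust-19200-p1` (gen 27),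
CHAIR WORD №28 «items 1–4 = T_J-free half → ★p1».  THEOREMS ONLY (0 `def`, 0 `sorry`); `--supports stmt-QuantumFields-19200 --as helper`; count-neutral.

WHY.  The perturbation `Δ′ := Δ_πᴾ − Δ^η = −(M†Δ^ηPᴾ + Δ^ηM)`, `M = DG′ᴾR_SD*`, of print's series `G_π = G₀(1 − Δ′G₀)⁻¹` ((3.130)) carries the curved Hessian ONLY through the two words `Δ^η∘D`
(at a flat background `Δ^η D = 0`) and `D*∘Δ^η`; print (3.117) writes both as the pairing with the current `J`, and the tree has that pairing as an IDENTITY: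
✓`Prop7DeltaPiDefectPairing.inner_DL2_toL2S_DeltaEta_toL2` `⟪D_{U₀}(toL2S λ), Δ^η_{U₀}(toL2 F)⟫ = c₀·η⁻³·2⁻¹·⟨i[λᴴ(b₋),F(b)] − i[F(b),R_bλᴴ(b₊)], J₁⟩` with ✓`norm_J_one_le_of_regPr`
`‖J₁(b)‖ ≤ α·η³` on `RegPr α U₀` (the DIVERGENCE clause — `η⁻³·η³ = 1`, no loss).  This file reads the identity against SPIKES (Riesz) to get the two pointwise rows the `𝒳∕𝒴`
Neumann knit (LOCATE-N6 §2(ii)) and the `h88` door (CHAIR LOCATE №26) consume.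

WHAT IS PROVED (ns `…Theorems.Prop7CurrentPairingPointwise`; member `F n K`, weight `c₀ > 0`, background `U₀`).
* §1 Riesz extraction on spikes: `inner_toL2_toL2_single` (`⟪toL2 V, toL2 δ_bE⟫ = c₀·tr((V b)ᴴE)`), `inner_toL2S_toL2S_single`, `trace_conjTranspose_mul_self`
  (`tr(XᴴX) = ‖frobEquiv⁻¹X‖²`), ★ `norm_apply_le_of_norm_inner_single_le` ∕ `norm_apply_le_of_norm_inner_siteSingle_le` (`‖⟪toL2 V, toL2 δ_b(V b)⟫‖ ≤ c₀·C·‖V b‖ ⟹ ‖V b‖ ≤ C`).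
* §2 ★ `norm_bondPair_bracket_single_le` — the (3.117) bracket tested against a bond spike `δ_bE` has ONE term: `≤ 4·j·(‖λ b₋‖ + ‖λ b₊‖)·‖E‖` for `‖J(b)‖ ≤ j`.
* §3 ★★★ `norm_symm_DeltaEta_DL2_toL2S_apply_le` — (C-val): on `RegPr F n K α U₀`, for EVERY gauge parameter `λ` and bond `b`,
  `‖(toL2⁻¹(Δ^η_{U₀}(D_{U₀}(toL2S λ))))(b)‖ ≤ 2·α·(‖λ b₋‖ + ‖λ b₊‖)`; ★★ `…_le_of_sup` (`≤ 4·α·sup‖λ‖`).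
* §4 ★★★ `norm_symm_DstarL2_DeltaEta_toL2_apply_le` — (C-div): on `RegPr F n K α U₀`, for every vector field `F` with `‖F(b)‖ ≤ s` and every site `x`,
  `‖(toL2S⁻¹(D*_{U₀}(Δ^η_{U₀}(toL2 F))))(x)‖ ≤ 12·α·s`.
EFFECT.  The two local `O(α)` letters of the N6 Neumann knit (`Δ′ : 𝒳 → 𝒴` has norm `≤ C·α`) are theorems; constants `2`, `4`, `12` — L-free, K-free, `c₀`-free.
HONEST SCOPE.  Riesz readings of a landed identity + the landed current bound; nothing of `norm_G`, the 8 EX print rows, `hThm2S`, EX `stub_existenceMinimalOrbit` or the crux is proved;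
nothing continuum ∕ OS ∕ mass-gap ∕ Clay.

References: T. Bałaban, CMP **99** (1985) 389–434 [Balaban1985BackgroundPropagators] ((3.10)–(3.12) p.392, (3.117) p.419, (3.130)–(3.131) pp.421–422);
CMP **102** (1985) 277–309 [Balaban1985Variational] ((28) p.282, (138) p.299); CMP **98** (1985) 17–51 [Balaban1985Averaging] ((20) p.21).
-/

set_option autoImplicit false

noncomputable section

open scoped Matrix.Norms.L2Operator BigOperators InnerProductSpace ComplexConjugate
open Complex (I)

namespace Summit.QuantumFields.YangMills.Theorems.Prop7CurrentPairingPointwise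

open Literature.MathematicalPhysics.QuantumFieldTheory.Balaban1983to89
open Literature.MathematicalPhysics.QuantumFieldTheory.Balaban1983to89.T3ContinuumYM3Torus
open T3PrintedRegularMinimiser (RegPr)
open T3SectALandauChart (formComp bgUnits eta eta_pos)
open B9TorusCalculus (torusT)
open B9Eq39Adjoint (R bondPair J)
open B9Eq310Hermitian (norm_R_le)
open B9Eq3131Pointwise (norm_I_ad_le)
open Beta.BackgroundVertices (ad ad_apply)
open B11Eq103H1Complex (SiteL2K BondL2K)
open Summit.QuantumFields.YangMills.Theorems.Prop7SectET3Transport (periodsT3)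
open Summit.QuantumFields.YangMills.Theorems.Prop7SectET3HilbertLetters (W₂ frobEquiv inner_frobEquiv_symm toL2 toL2S inner_toL2 DL2 DstarL2 adjoint_DL2)
open Summit.QuantumFields.YangMills.Theorems.Prop7SectET3RealCoordSums (inner_toL2S)
open Summit.QuantumFields.YangMills.Theorems.Prop7SectET3WilsonHessian (DeltaEta DeltaEta_isSymmetric)
open Summit.QuantumFields.YangMills.Theorems.Prop7SecondOrderDict (norm_bgUnits_le_one)
open Summit.QuantumFields.YangMills.Theorems.Prop7RieszTauFrobNorm (norm_le_norm_frobEquiv_symm)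
open Summit.QuantumFields.YangMills.Theorems.Prop7DeltaPiDefectPairing (inner_DL2_toL2S_DeltaEta_toL2 norm_bondPair_linJ_le norm_J_one_le_of_regPr)

variable {F : T3Family} {n K : ℕ} {c₀ : ℝ}

/-! ## §1 Riesz extraction: the value of a field at a bond ∕ site from its pairing with the spike there -/

section Riesz

variable [Fact (0 < c₀)]

/-- `⟪toL2 V, toL2 (δ_b E)⟫ = c₀·tr((V b)ᴴ E)` — print's (3.11) pairing against a one-bond spike. [cite: Balaban1985BackgroundPropagators, (3.11) p.392] -/
theorem inner_toL2_toL2_single (V : PBond (F.P K) 0 → Matrix (Fin 2) (Fin 2) ℂ) (b : PBond (F.P K) 0) (E : Matrix (Fin 2) (Fin 2) ℂ) :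
    ⟪toL2 F K c₀ V, toL2 F K c₀ (Pi.single b E)⟫_ℂ = (c₀ : ℂ) * Matrix.trace ((V b).conjTranspose * E) := by
  rw [inner_toL2, Finset.sum_eq_single b]
  · rw [Pi.single_eq_same]
  · intro b' _ hb'
    rw [Pi.single_eq_of_ne hb', mul_zero, Matrix.trace_zero]
  · intro hb
    exact absurd (Finset.mem_univ b) hb

/-- `⟪toL2S W, toL2S (δ_x E)⟫ = c₀·tr((W x)ᴴ E)` — the same on the gauge parameters. [cite: Balaban1985BackgroundPropagators, p.393] -/
theorem inner_toL2S_toL2S_single (W : Site (F.P K) 0 → Matrix (Fin 2) (Fin 2) ℂ) (x : Site (F.P K) 0) (E : Matrix (Fin 2) (Fin 2) ℂ) :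
    ⟪toL2S F K c₀ W, toL2S F K c₀ (Pi.single x E)⟫_ℂ = (c₀ : ℂ) * Matrix.trace ((W x).conjTranspose * E) := by
  rw [inner_toL2S, Finset.sum_eq_single x]
  · rw [Pi.single_eq_same]
  · intro x' _ hx'
    rw [Pi.single_eq_of_ne hx', mul_zero, Matrix.trace_zero]
  · intro hx
    exact absurd (Finset.mem_univ x) hx

omit [Fact (0 < c₀)] in
/-- `tr(XᴴX) = ‖frobEquiv⁻¹ X‖²` (the un-normalised Frobenius norm squared, as a complex number). [cite: Balaban1985Averaging, (18) p.21] -/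
theorem trace_conjTranspose_mul_self (X : Matrix (Fin 2) (Fin 2) ℂ) :
    Matrix.trace (X.conjTranspose * X) = (((‖(frobEquiv.symm X : W₂)‖ ^ 2 : ℝ)) : ℂ) := by
  rw [← inner_frobEquiv_symm, inner_self_eq_norm_sq_to_K]
  norm_cast

/-- ★ **RIESZ EXTRACTION ON A BOND SPIKE**: if `‖⟪toL2 V, toL2 (δ_b (V b))⟫‖ ≤ c₀·C·‖V b‖` with `0 ≤ C`, then `‖V b‖ ≤ C` (`⟪toL2 V, toL2 δ_b(V b)⟫ = c₀·‖frobEquiv⁻¹(V b)‖²` and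
`|X| ≤ ‖frobEquiv⁻¹X‖`, ✓`norm_le_norm_frobEquiv_symm`). [cite: Balaban1985Averaging, (20) p.21; Balaban1985BackgroundPropagators, (3.11) p.392] -/
theorem norm_apply_le_of_norm_inner_single_le (V : PBond (F.P K) 0 → Matrix (Fin 2) (Fin 2) ℂ) (b : PBond (F.P K) 0) {C : ℝ} (hC : 0 ≤ C)
    (h : ‖⟪toL2 F K c₀ V, toL2 F K c₀ (Pi.single b (V b))⟫_ℂ‖ ≤ c₀ * C * ‖V b‖) : ‖V b‖ ≤ C := by
  have hc₀ : 0 < c₀ := Fact.out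
  set w : W₂ := frobEquiv.symm (V b) with hw
  have hVw : ‖V b‖ ≤ ‖w‖ := norm_le_norm_frobEquiv_symm (V b)
  have hin : ‖⟪toL2 F K c₀ V, toL2 F K c₀ (Pi.single b (V b))⟫_ℂ‖ = c₀ * ‖w‖ ^ 2 := by
    rw [inner_toL2_toL2_single, trace_conjTranspose_mul_self, ← hw, ← Complex.ofReal_mul, Complex.norm_real, Real.norm_of_nonneg (by positivity)]
  rcases (norm_nonneg w).eq_or_lt with h0 | hpos
  · linarith [hVw]
  · have h1 : c₀ * ‖w‖ ^ 2 ≤ c₀ * C * ‖w‖ := by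
      rw [← hin]
      exact h.trans (mul_le_mul_of_nonneg_left hVw (by positivity))
    have h2 : ‖w‖ ≤ C := by
      rcases le_or_gt ‖w‖ C with hle | hlt
      · exact hle
      · have : c₀ * C * ‖w‖ < c₀ * ‖w‖ ^ 2 := by nlinarith [mul_pos hc₀ hpos]
        linarith
    exact hVw.trans h2

/-- ★ **RIESZ EXTRACTION ON A SITE SPIKE**: `‖⟪toL2S W, toL2S (δ_x (W x))⟫‖ ≤ c₀·C·‖W x‖`, `0 ≤ C` ⟹ `‖W x‖ ≤ C`. [cite: Balaban1985Averaging, (20) p.21] -/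
theorem norm_apply_le_of_norm_inner_siteSingle_le (W : Site (F.P K) 0 → Matrix (Fin 2) (Fin 2) ℂ) (x : Site (F.P K) 0) {C : ℝ} (hC : 0 ≤ C)
    (h : ‖⟪toL2S F K c₀ W, toL2S F K c₀ (Pi.single x (W x))⟫_ℂ‖ ≤ c₀ * C * ‖W x‖) : ‖W x‖ ≤ C := by
  have hc₀ : 0 < c₀ := Fact.out
  set w : W₂ := frobEquiv.symm (W x) with hw
  have hVw : ‖W x‖ ≤ ‖w‖ := norm_le_norm_frobEquiv_symm (W x)
  have hin : ‖⟪toL2S F K c₀ W, toL2S F K c₀ (Pi.single x (W x))⟫_ℂ‖ = c₀ * ‖w‖ ^ 2 := by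
    rw [inner_toL2S_toL2S_single, trace_conjTranspose_mul_self, ← hw, ← Complex.ofReal_mul, Complex.norm_real, Real.norm_of_nonneg (by positivity)]
  rcases (norm_nonneg w).eq_or_lt with h0 | hpos
  · linarith [hVw]
  · have h1 : c₀ * ‖w‖ ^ 2 ≤ c₀ * C * ‖w‖ := by
      rw [← hin]
      exact h.trans (mul_le_mul_of_nonneg_left hVw (by positivity))
    have h2 : ‖w‖ ≤ C := by
      rcases le_or_gt ‖w‖ C with hle | hlt
      · exact hle
      · have : c₀ * C * ‖w‖ < c₀ * ‖w‖ ^ 2 := by nlinarith [mul_pos hc₀ hpos]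
        linarith
    exact hVw.trans h2

end Riesz

/-! ## §2 The (3.117) bracket against a bond spike: one term -/

/-- ★ **THE BRACKET OF (3.117) TESTED AGAINST A BOND SPIKE HAS ONE TERM**: for `‖J(b)‖ ≤ j` everywhere,
`‖⟨i[λ(b₋), (δ_bE)(b)] − i[(δ_bE)(b), R_bλ(b₊)], J⟩₁‖ ≤ 4·j·(‖λ b₋‖ + ‖λ b₊‖)·‖E‖` (unit spacing, `d = 3`, `τ := tr`; ✓`norm_I_ad_le`, unitary transport `‖R_bλ(b₊)‖ ≤ ‖λ(b₊)‖`,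
`|tr(XY)| ≤ 2|X||Y|`). [cite: Balaban1985BackgroundPropagators, (3.117) p.419, (3.131) p.422] -/
theorem norm_bondPair_bracket_single_le (U₀ : GaugeField (F.P K) 0 (Matrix.specialUnitaryGroup (Fin 2) ℂ)) (lam : Site (F.P K) 0 → Matrix (Fin 2) (Fin 2) ℂ)
    (b : PBond (F.P K) 0) (E : Matrix (Fin 2) (Fin 2) ℂ) (Jf : Fin (F.P K).d → Site (F.P K) 0 → Matrix (Fin 2) (Fin 2) ℂ) {j : ℝ} (hJ : ∀ μ x, ‖Jf μ x‖ ≤ j) :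
    ‖bondPair 1 3 (Matrix.traceLinearMap (Fin 2) ℂ ℂ)
        (fun μ x => I • ad (lam x) (formComp (Pi.single b E) μ x) - I • ad (formComp (Pi.single b E) μ x) (R (bgUnits F K U₀ ⟨x, μ⟩) (lam (torusT (F.P K) 0 μ x)))) Jf‖
      ≤ 4 * j * (‖lam b.src‖ + ‖lam b.tgt‖) * ‖E‖ := by
  have hj : 0 ≤ j := (norm_nonneg _).trans (hJ b.dir b.src)
  -- the spike: `formComp (δ_b E) μ x = E` at `(x, μ) = (b₋, dir b)` and `0` elsewhere
  have hfc : ∀ (μ : Fin (F.P K).d) (x : Site (F.P K) 0), formComp (Pi.single b E) μ x = if (⟨x, μ⟩ : PBond (F.P K) 0) = b then E else 0 := by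
    intro μ x
    simp only [formComp]
    by_cases hb : (⟨x, μ⟩ : PBond (F.P K) 0) = b
    · rw [if_pos hb, hb, Pi.single_eq_same]
    · rw [if_neg hb, Pi.single_eq_of_ne hb]
  rw [bondPair, Complex.ofReal_one, one_pow, one_mul]
  -- collapse the double sum to the single term `(b.src, b.dir)`
  rw [Finset.sum_eq_single b.src]
  · rw [Finset.sum_eq_single b.dir]
    · -- the surviving term
      have hb : (⟨b.src, b.dir⟩ : PBond (F.P K) 0) = b := rfl
      rw [hfc, if_pos hb, Matrix.traceLinearMap_apply, B9TorusCalculus.torusT_apply]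
      refine (FlatPlaqDeriv.norm_trace_mul_le _ _).trans ?_
      have hR : ‖R (bgUnits F K U₀ ⟨b.src, b.dir⟩) (lam (b.src.shift b.dir))‖ ≤ ‖lam b.tgt‖ :=
        norm_R_le (norm_bgUnits_le_one F K U₀ ⟨b.src, b.dir⟩).1 (norm_bgUnits_le_one F K U₀ ⟨b.src, b.dir⟩).2 _
      have h1 : ‖I • ad (lam b.src) E‖ ≤ 2 * ‖lam b.src‖ * ‖E‖ := norm_I_ad_le _ _
      have h2 : ‖I • ad E (R (bgUnits F K U₀ ⟨b.src, b.dir⟩) (lam (b.src.shift b.dir)))‖ ≤ 2 * ‖E‖ * ‖lam b.tgt‖ :=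
        (norm_I_ad_le _ _).trans (by nlinarith [hR, norm_nonneg E, norm_nonneg (R (bgUnits F K U₀ ⟨b.src, b.dir⟩) (lam (b.src.shift b.dir)))])
      have hbr : ‖I • ad (lam b.src) E - I • ad E (R (bgUnits F K U₀ ⟨b.src, b.dir⟩) (lam (b.src.shift b.dir)))‖ ≤ 2 * (‖lam b.src‖ + ‖lam b.tgt‖) * ‖E‖ :=
        (norm_sub_le _ _).trans (by linarith [h1, h2])
      have hJb := hJ b.dir b.src
      calc 2 * ‖I • ad (lam b.src) E - I • ad E (R (bgUnits F K U₀ ⟨b.src, b.dir⟩) (lam (b.src.shift b.dir)))‖ * ‖Jf b.dir b.src‖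
          ≤ 2 * (2 * (‖lam b.src‖ + ‖lam b.tgt‖) * ‖E‖) * j := by
            exact mul_le_mul (mul_le_mul_of_nonneg_left hbr (by norm_num)) hJb (norm_nonneg _) (by positivity)
        _ = 4 * j * (‖lam b.src‖ + ‖lam b.tgt‖) * ‖E‖ := by ring
    · intro μ _ hμ
      have hne : (⟨b.src, μ⟩ : PBond (F.P K) 0) ≠ b := fun e => hμ (by rw [← e])
      rw [hfc, if_neg hne]
      simp only [ad_apply, mul_zero, zero_mul, sub_self, smul_zero, map_zero]
    · intro hb
      exact absurd (Finset.mem_univ _) hb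
  · intro x _ hx
    refine Finset.sum_eq_zero fun μ _ => ?_
    have hne : (⟨x, μ⟩ : PBond (F.P K) 0) ≠ b := fun e => hx (by rw [← e])
    rw [hfc, if_neg hne]
    simp only [ad_apply, mul_zero, zero_mul, sub_self, smul_zero, map_zero]
  · intro hx
    exact absurd (Finset.mem_univ _) hx

/-! ## §3 (C-val): `Δ^η_{U₀} ∘ D_{U₀}` is a local `O(α)` multiplier on `RegPr` -/

section CVal

variable [Fact (0 < c₀)]

/-- ★★★ **(C-val) — THE CURVED HESSIAN ON PURE GAUGES, POINTWISE**: on `RegPr F n K α U₀`, for EVERY gauge parameter `λ` and every bond `b`,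
`‖(toL2⁻¹(Δ^η_{U₀}(D_{U₀}(toL2S λ))))(b)‖ ≤ 2·α·(‖λ(b₋)‖ + ‖λ(b₊)‖)` (at a flat background the left side is `0`: `curl ∘ grad = 0`).  PROOF: Riesz against the spike
`δ_b(V b)`, `Δ^η` symmetric (✓`DeltaEta_isSymmetric`), the pairing identity ✓`inner_DL2_toL2S_DeltaEta_toL2`, the one-term bracket (§2) with `‖J₁(b)‖ ≤ αη³`
(✓`norm_J_one_le_of_regPr`): `c₀‖V b‖² ≤ c₀η⁻³·2⁻¹·4·αη³·(…)·‖V b‖`. [cite: Balaban1985BackgroundPropagators, (3.117) p.419, (3.131) p.422; Balaban1985Variational, (28) p.282, (138) p.299] -/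
theorem norm_symm_DeltaEta_DL2_toL2S_apply_le {α : ℝ} (U₀ : GaugeField (F.P K) 0 (Matrix.specialUnitaryGroup (Fin 2) ℂ)) (hreg : RegPr F n K α U₀)
    (lam : Site (F.P K) 0 → Matrix (Fin 2) (Fin 2) ℂ) (b : PBond (F.P K) 0) :
    ‖(toL2 F K c₀).symm (DeltaEta F n K c₀ U₀ (DL2 F n K c₀ U₀ (toL2S F K c₀ lam))) b‖ ≤ 2 * α * (‖lam b.src‖ + ‖lam b.tgt‖) := by
  have hc₀ : 0 < c₀ := Fact.out
  have hη : 0 < eta F n K := eta_pos F n K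
  -- `0 ≤ α` from the current bound at any bond
  have hJ := norm_J_one_le_of_regPr U₀ hreg
  have hα : 0 ≤ α := by
    have h0 : 0 * eta F n K ^ 3 ≤ α * eta F n K ^ 3 := by rw [zero_mul]; exact (norm_nonneg _).trans (hJ b.dir b.src)
    exact le_of_mul_le_mul_right h0 (pow_pos hη 3)
  set V : PBond (F.P K) 0 → Matrix (Fin 2) (Fin 2) ℂ := (toL2 F K c₀).symm (DeltaEta F n K c₀ U₀ (DL2 F n K c₀ U₀ (toL2S F K c₀ lam))) with hV
  have hVeq : toL2 F K c₀ V = DeltaEta F n K c₀ U₀ (DL2 F n K c₀ U₀ (toL2S F K c₀ lam)) := LinearEquiv.apply_symm_apply _ _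
  refine norm_apply_le_of_norm_inner_single_le (c₀ := c₀) V b (by positivity) ?_
  -- move `Δ^η` to the spike, then the pairing identity
  have hs := DeltaEta_isSymmetric (n := n) (c₀ := c₀) U₀ (DL2 F n K c₀ U₀ (toL2S F K c₀ lam)) (toL2 F K c₀ (Pi.single b (V b)))
  simp only [ContinuousLinearMap.coe_coe] at hs
  rw [hVeq, hs, inner_DL2_toL2S_DeltaEta_toL2 U₀ lam (Pi.single b (V b))]
  -- the one-term bracket with `λᴴ` and `J₁`
  have hbr := norm_bondPair_bracket_single_le U₀ (star lam) b (V b)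
    (J (torusT (F.P K) 0) (fun μ x => bgUnits F K U₀ ⟨x, μ⟩) 1) (fun μ x => hJ μ x)
  have hstar : ∀ x : Site (F.P K) 0, ‖(star lam) x‖ = ‖lam x‖ := fun x => by
    rw [Pi.star_apply, Matrix.star_eq_conjTranspose, Matrix.l2_opNorm_conjTranspose]
  rw [hstar, hstar] at hbr
  have hcoef : ‖(c₀ : ℂ) * ((((eta F n K)⁻¹ ^ 3 : ℝ) : ℂ)) * (2 : ℂ)⁻¹‖ = c₀ * (eta F n K)⁻¹ ^ 3 * 2⁻¹ := by
    rw [norm_mul, norm_mul, Complex.norm_real, Complex.norm_real, Real.norm_of_nonneg hc₀.le, Real.norm_of_nonneg (by positivity), norm_inv,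
      RCLike.norm_two]
  rw [norm_mul, hcoef]
  calc c₀ * (eta F n K)⁻¹ ^ 3 * 2⁻¹ * ‖bondPair 1 3 (Matrix.traceLinearMap (Fin 2) ℂ ℂ)
          (fun μ x => I • ad (star lam x) (formComp (Pi.single b (V b)) μ x) - I • ad (formComp (Pi.single b (V b)) μ x) (R (bgUnits F K U₀ ⟨x, μ⟩) (star lam (torusT (F.P K) 0 μ x))))
          (J (torusT (F.P K) 0) (fun μ x => bgUnits F K U₀ ⟨x, μ⟩) 1)‖
      ≤ c₀ * (eta F n K)⁻¹ ^ 3 * 2⁻¹ * (4 * (α * eta F n K ^ 3) * (‖lam b.src‖ + ‖lam b.tgt‖) * ‖V b‖) :=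
        mul_le_mul_of_nonneg_left hbr (by positivity)
    _ = c₀ * (2 * α * (‖lam b.src‖ + ‖lam b.tgt‖)) * ‖V b‖ := by
        field_simp
        ring

/-- ★★ **(C-val), SUP FORM**: on `RegPr F n K α U₀`, `‖(toL2⁻¹(Δ^η_{U₀}(D_{U₀}(toL2S λ))))(b)‖ ≤ 4·α·m` whenever `‖λ x‖ ≤ m` for all `x` — the word `Δ^ηM` of `Δ′` maps
`L^∞` gauge parameters to `L^∞` fields with norm `O(α)`. [cite: Balaban1985BackgroundPropagators, (3.117) p.419, (3.131) p.422] -/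
theorem norm_symm_DeltaEta_DL2_toL2S_apply_le_of_sup {α : ℝ} (U₀ : GaugeField (F.P K) 0 (Matrix.specialUnitaryGroup (Fin 2) ℂ)) (hreg : RegPr F n K α U₀)
    (lam : Site (F.P K) 0 → Matrix (Fin 2) (Fin 2) ℂ) {m : ℝ} (hm : ∀ x, ‖lam x‖ ≤ m) (b : PBond (F.P K) 0) :
    ‖(toL2 F K c₀).symm (DeltaEta F n K c₀ U₀ (DL2 F n K c₀ U₀ (toL2S F K c₀ lam))) b‖ ≤ 4 * α * m := by
  have hη : 0 < eta F n K := eta_pos F n K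
  have hJ := norm_J_one_le_of_regPr U₀ hreg b.dir b.src
  have hα : 0 ≤ α := by
    have h0 : 0 * eta F n K ^ 3 ≤ α * eta F n K ^ 3 := by rw [zero_mul]; exact (norm_nonneg _).trans hJ
    exact le_of_mul_le_mul_right h0 (pow_pos hη 3)
  have h := norm_symm_DeltaEta_DL2_toL2S_apply_le (c₀ := c₀) U₀ hreg lam b
  have h2 : ‖lam b.src‖ + ‖lam b.tgt‖ ≤ 2 * m := by linarith [hm b.src, hm b.tgt]
  nlinarith [h, h2]

end CVal

/-! ## §4 (C-div): `D*_{U₀} ∘ Δ^η_{U₀}` is a local `O(α)` multiplier on `RegPr` -/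

section CDiv

variable [Fact (0 < c₀)]

/-- ★★★ **(C-div) — THE COVARIANT DIVERGENCE OF THE CURVED HESSIAN, POINTWISE**: on `RegPr F n K α U₀`, for every vector field `F` with `‖F(b)‖ ≤ s` and every site `x`,
`‖(toL2S⁻¹(D*_{U₀}(Δ^η_{U₀}(toL2 F))))(x)‖ ≤ 12·α·s` (at a flat background the left side is `0`: `div ∘ curl* curl = 0`).  PROOF: Riesz against the site spike `δ_x(W x)`,
`⟪D*u, v⟫ = ⟪u, Dv⟫` (✓`adjoint_DL2`), the pairing identity with `λ := δ_x(W x)` and the `L^∞ × L¹` bracket bound ✓`norm_bondPair_linJ_le` (`Σ_y‖δ_x E y‖ = ‖E‖`), `‖J₁‖ ≤ αη³`.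
[cite: Balaban1985BackgroundPropagators, (3.117) p.419, (3.8) p.392, (3.131) p.422; Balaban1985Variational, (28) p.282, (138)–(139) p.299] -/
theorem norm_symm_DstarL2_DeltaEta_toL2_apply_le {α : ℝ} (U₀ : GaugeField (F.P K) 0 (Matrix.specialUnitaryGroup (Fin 2) ℂ)) (hreg : RegPr F n K α U₀)
    (Fv : PBond (F.P K) 0 → Matrix (Fin 2) (Fin 2) ℂ) {s : ℝ} (hF : ∀ b, ‖Fv b‖ ≤ s) (x : Site (F.P K) 0) :
    ‖(toL2S F K c₀).symm (DstarL2 F n K c₀ U₀ (DeltaEta F n K c₀ U₀ (toL2 F K c₀ Fv))) x‖ ≤ 12 * α * s := by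
  have hc₀ : 0 < c₀ := Fact.out
  have hη : 0 < eta F n K := eta_pos F n K
  have hJ := norm_J_one_le_of_regPr U₀ hreg
  have hα : 0 ≤ α := by
    have h0 : 0 * eta F n K ^ 3 ≤ α * eta F n K ^ 3 := by rw [zero_mul]; exact (norm_nonneg _).trans (hJ 0 x)
    exact le_of_mul_le_mul_right h0 (pow_pos hη 3)
  have hs : 0 ≤ s := (norm_nonneg _).trans (hF ⟨x, 0⟩)
  set W : Site (F.P K) 0 → Matrix (Fin 2) (Fin 2) ℂ := (toL2S F K c₀).symm (DstarL2 F n K c₀ U₀ (DeltaEta F n K c₀ U₀ (toL2 F K c₀ Fv))) with hW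
  have hWeq : toL2S F K c₀ W = DstarL2 F n K c₀ U₀ (DeltaEta F n K c₀ U₀ (toL2 F K c₀ Fv)) := LinearEquiv.apply_symm_apply _ _
  refine norm_apply_le_of_norm_inner_siteSingle_le (c₀ := c₀) W x (by positivity) ?_
  set lam₀ : Site (F.P K) 0 → Matrix (Fin 2) (Fin 2) ℂ := Pi.single x (W x) with hlam₀
  -- `⟪D*Δ^ηF̃, μ̃⟫ = ⟪Δ^ηF̃, Dμ̃⟫ = conj ⟪Dμ̃, Δ^ηF̃⟫`
  have had : ⟪DstarL2 F n K c₀ U₀ (DeltaEta F n K c₀ U₀ (toL2 F K c₀ Fv)), toL2S F K c₀ lam₀⟫_ℂ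
      = ⟪DeltaEta F n K c₀ U₀ (toL2 F K c₀ Fv), DL2 F n K c₀ U₀ (toL2S F K c₀ lam₀)⟫_ℂ := by
    rw [← adjoint_DL2, LinearMap.adjoint_inner_left]
  rw [hWeq, had, ← inner_conj_symm, RCLike.norm_conj, inner_DL2_toL2S_DeltaEta_toL2 U₀ lam₀ Fv]
  -- the `L^∞ × L¹` bracket bound with `λ := (δ_x (W x))ᴴ`
  have hF' : ∀ (μ : Fin (F.P K).d) (y : Site (F.P K) 0), ‖formComp Fv μ y‖ ≤ s := fun μ y => hF ⟨y, μ⟩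
  have hbr := norm_bondPair_linJ_le U₀ (star lam₀) (formComp Fv)
    (J (torusT (F.P K) 0) (fun μ x => bgUnits F K U₀ ⟨x, μ⟩) 1) hF' (fun μ y => hJ μ y)
  -- `Σ_y ‖(δ_x E)ᴴ y‖ = ‖E‖`
  have hsum : ∑ y : Site (F.P K) 0, ‖(star lam₀) y‖ = ‖W x‖ := by
    rw [Finset.sum_eq_single x]
    · rw [Pi.star_apply, hlam₀, Pi.single_eq_same, Matrix.star_eq_conjTranspose, Matrix.l2_opNorm_conjTranspose]
    · intro y _ hy
      rw [Pi.star_apply, hlam₀, Pi.single_eq_of_ne hy, star_zero, norm_zero]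
    · intro hx
      exact absurd (Finset.mem_univ x) hx
  rw [hsum] at hbr
  have hcoef : ‖(c₀ : ℂ) * ((((eta F n K)⁻¹ ^ 3 : ℝ) : ℂ)) * (2 : ℂ)⁻¹‖ = c₀ * (eta F n K)⁻¹ ^ 3 * 2⁻¹ := by
    rw [norm_mul, norm_mul, Complex.norm_real, Complex.norm_real, Real.norm_of_nonneg hc₀.le, Real.norm_of_nonneg (by positivity), norm_inv,
      RCLike.norm_two]
  rw [norm_mul, hcoef]
  calc c₀ * (eta F n K)⁻¹ ^ 3 * 2⁻¹ * ‖bondPair 1 3 (Matrix.traceLinearMap (Fin 2) ℂ ℂ)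
          (fun μ y => I • ad (star lam₀ y) (formComp Fv μ y) - I • ad (formComp Fv μ y) (R (bgUnits F K U₀ ⟨y, μ⟩) (star lam₀ (torusT (F.P K) 0 μ y))))
          (J (torusT (F.P K) 0) (fun μ x => bgUnits F K U₀ ⟨x, μ⟩) 1)‖
      ≤ c₀ * (eta F n K)⁻¹ ^ 3 * 2⁻¹ * (24 * s * (α * eta F n K ^ 3) * ‖W x‖) :=
        mul_le_mul_of_nonneg_left hbr (by positivity)
    _ = c₀ * (12 * α * s) * ‖W x‖ := by
        field_simp
        ring

end CDiv

end Summit.QuantumFields.YangMills.Theorems.Prop7CurrentPairingPointwise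

end
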